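import Literature.AlgebraicGeometry.Frobenioids.ArchimedeanIstrProofs
import HarnessLib

/-!
# Frobenioids II, Theorem 3.6 (ii), first clause — PROVED: "`A^istr` is of base-trivial type"

Mochizuki, *The geometry of Frobenioids II*, Kyushu J. Math. **62** (2008) 401–460, §3, Theorem 3.6
(ii), author's kurims text p. 37 [cite: MochizukiFrdII2008, Thm 3.6 (ii) p.37]: "The Frobenioid `A^istr`
is of base-trivial and model type …". DISCHARGE of `ArchFrd.Thm36ii_istrBaseTrivial` of
`ArchimedeanBasicProperties.lean` at the angular Frobenioid `A π ⊆ C π` of Example 3.3 (iii) over any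
base `π : D → D₀` (`AngularFrobenioidsRelative.lean`, seat abc-iut-L1-t6), with its own structure
`A.toElem π` (zero divisor monoid): an object of `A` isotropic in the sense of [FrdI] Def. 1.2 (iv) has
naively isotropic `C₀`-component (the hull arrow of `ArchimedeanIstrProofs.lean` is an isometry, hence an
arrow of `A`, and an isometric pre-step there), and two such objects over isomorphic objects of `D` are
isomorphic in `A` by the rescaling isomorphism of `C` (`isoOverOfIsotropic`), whose components are
isometries. No statement of the paper is strengthened.
-/

namespace Literature.AlgebraicGeometry.Frobenioids

open CategoryTheory

universe v u

namespace ArchFrd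

variable {D : Type u} [Category.{v} D] (π : D ⥤ D0)

/-- The hull arrow of `C` is an isometry. [cite: MochizukiFrdII2008, Ex 3.3 (ii) p.28] -/
theorem isIsometry_hullArrowOver (X : C π) :
    PreFrobenioid.IsIsometry (C.toElem π) (hullArrowOver π X) := by
  change pull Φ₀ X.iso.inv (PreFrobenioid.Div C0.toElem (C0.hullArrow X.fst)) = 1
  rw [(C0.isIsometry_isPreStep_hullArrow X.fst).1]
  exact map_one _

/-- In the angular Frobenioid `A`, an object isotropic in the sense of [FrdI] Def. 1.2 (iv) (for the
structure `A.toElem`) has naively isotropic `C₀`-component (Ex. 3.3 (iii): "an object of `A` is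
isotropic iff it maps to an isotropic object of `A₀`", direction `⇒`).
[cite: MochizukiFrdII2008, Ex 3.3 (iii) p.29] -/
theorem A.isNaivelyIsotropic_of_isIsotropic (X : A π)
    (h : PreFrobenioid.IsIsotropic (A.toElem π) X) : X.obj.fst.IsNaivelyIsotropic := by
  let Y : A π := ⟨⟨⟨X.obj.fst.base, AngularRegion.isotropicOfTip X.obj.fst.region.tip,
      fun _ => AngularRegion.isIsotropic_isotropicOfTip _⟩, X.obj.snd, X.obj.iso⟩⟩
  let a : X ⟶ Y := ⟨hullArrowOver π X.obj, isIsometry_hullArrowOver π X.obj⟩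
  have hi : PreFrobenioid.IsIsometry (A.toElem π) a := Subsingleton.elim _ _
  have hp : PreFrobenioid.IsPreStep (A.toElem π) a := by
    refine ⟨(C0.isIsometry_isPreStep_hullArrow X.obj.fst).2.1, ?_⟩
    change IsIso (𝟙 X.obj.snd)
    infer_instance
  haveI : IsIso a := h a hi hp
  haveI : IsIso (hullArrowOver π X.obj) := Functor.map_isIso (A.ι π) a
  haveI : IsIso (C0.hullArrow X.obj.fst) := CFP.isIso_fst (hullArrowOver π X.obj)
  exact C0.isNaivelyIsotropic_of_isIso_hullArrow X.obj.fst

/-- The rescaling isomorphism of `C₀` between naively isotropic objects has isometric components.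
[cite: MochizukiFrdII2008, Ex 3.3 (iv) p.29] -/
theorem C0.isIsometry_isoOfIsotropic_hom {X Y : C0} (β : X.base ≅ Y.base) (hX : X.IsNaivelyIsotropic)
    (hY : Y.IsNaivelyIsotropic) : PreFrobenioid.IsIsometry C0.toElem (C0.isoOfIsotropic β hX hY).hom := by
  rw [A0.isIsometry_iff_norm_mul_tip_pow]
  change ‖(N0.rescale X Y : ℂ)‖ * X.tip ^ ((1 : ℕ+) : ℕ) = Y.tip
  rw [N0.norm_rescale, PNat.one_coe, pow_one, div_mul_cancel₀ _ X.tip_pos.ne']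

/-- … and so does its inverse. [cite: MochizukiFrdII2008, Ex 3.3 (iv) p.29] -/
theorem C0.isIsometry_isoOfIsotropic_inv {X Y : C0} (β : X.base ≅ Y.base) (hX : X.IsNaivelyIsotropic)
    (hY : Y.IsNaivelyIsotropic) : PreFrobenioid.IsIsometry C0.toElem (C0.isoOfIsotropic β hX hY).inv := by
  rw [A0.isIsometry_iff_norm_mul_tip_pow]
  change ‖(N0.rescale Y X : ℂ)‖ * Y.tip ^ ((1 : ℕ+) : ℕ) = X.tip
  rw [N0.norm_rescale, PNat.one_coe, pow_one, div_mul_cancel₀ _ Y.tip_pos.ne']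

/-- The rescaling isomorphism of `C` (`isoOverOfIsotropic`) is an isomorphism of `A`: its components are
isometries. [cite: MochizukiFrdII2008, Thm 3.6 (ii) p.37] -/
noncomputable def A.isoOverOfIsotropic (X Y : A π) (e : X.obj.snd ≅ Y.obj.snd)
    (hX : X.obj.fst.IsNaivelyIsotropic) (hY : Y.obj.fst.IsNaivelyIsotropic) : X ≅ Y :=
  CategoryTheory.isoMk (ArchFrd.isoOverOfIsotropic π X.obj Y.obj e hX hY)
    (by
      change pull Φ₀ X.obj.iso.inv (PreFrobenioid.Div C0.toElem (C0.isoOfIsotropic _ hX hY).hom) = 1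
      rw [C0.isIsometry_isoOfIsotropic_hom]; exact map_one _)
    (by
      change pull Φ₀ Y.obj.iso.inv (PreFrobenioid.Div C0.toElem (C0.isoOfIsotropic _ hX hY).inv) = 1
      rw [C0.isIsometry_isoOfIsotropic_inv]; exact map_one _)

/-- **Theorem 3.6 (ii), first clause, for the angular Frobenioid `A`** (PROVED): `A^istr` is of
base-trivial type. [cite: MochizukiFrdII2008, Thm 3.6 (ii) p.37] -/
theorem thm36ii_istrBaseTrivial_A : Thm36ii_istrBaseTrivial (A.toElem π) := by
  rintro X Y ⟨e⟩
  exact ⟨(PreFrobenioid.isotropicObjects (A.toElem π)).ι.preimageIso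
    (A.isoOverOfIsotropic π Y.obj X.obj e.symm
      (A.isNaivelyIsotropic_of_isIsotropic π Y.obj Y.property)
      (A.isNaivelyIsotropic_of_isIsotropic π X.obj X.property))⟩

/-- `A^istr` is also of isotropic type (generic: `isOfIsotropicType_istr`), so the pair "isotropic,
base-trivial" of Thm. 3.6 (i)'s shape holds for `A` as well. [cite: MochizukiFrdII2008, Thm 3.6 (ii) p.37] -/
theorem thm36i_istrTypes_A : Thm36i_istrTypes (A.toElem π) :=
  ⟨isOfIsotropicType_istr (A.toElem π), thm36ii_istrBaseTrivial_A π⟩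

end ArchFrd

end Literature.AlgebraicGeometry.Frobenioids
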